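import Literature.Probability.RandomPlanarGeometry.ObservableShortTime
import Literature.Probability.RandomPlanarGeometry.LoewnerDriverStability
import HarnessLib

/-!
# The FK observable depends continuously on the driving function (short-time regime)

Topic `Probability/RandomPlanarGeometry`; theorems only (deterministic Loewner calculus). First
piece of glue for layer 6 of the decomposition of crit-ising.S17 (FK)
(`Literature.Probability.LatticeModels.convergesInLawToSLE_sixteen_thirds_fkInterface`;
Chelkak–Duminil-Copin–Hongler–Kemppainen–Smirnov, C. R. Math. 352 (2014), Thm. 2): in the
passage of the discrete observable martingales to the scaling limit, CDHKS (§3) use "the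
convergence of `G_t^δ` to `G_t` in the bulk of `ℍ_t` (which follows from the convergences of
`W_t^δ` to `W_t`)", i.e. the continuity of the observable `M_t(z)` as a functional of the driving
function for the uniform norm on `[0, t]`. For the FK observable
`O_t(iy) = (iy g_t'(iy)/(g_t(iy) - W_t))^{1/2}` (`Loewner.fkObservable`) in the short-time regime
`9t ≤ y²` (`Loewner.ShortTime`, `ObservableShortTime.lean`) this file proves:

* `ShortTime.dist_map_le`: `‖g_s^{W}(z) - g_s^{W₀}(z)‖ ≤ ω (e^{18s/(Im z)²} - 1)` when
  `|W - W₀| ≤ ω` on `[0, t]` and `ω` is small — the tree's driver-stability estimate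
  `dist_map_le_of_driving_close` (`LoewnerDriverStability.lean`, Lawler §4.7) with the
  driver-free tube radius `δ = (2/3) Im z` of the short-time regime;
* `ShortTime.norm_exponent_sub_exponent_le`, `ShortTime.norm_base_sub_base_le`: the exponents
  `∫₀ᵗ -2/(g_s - W_s)²` and the squares `z g_t'/(g_t - W_t)` are `C(z, t) ω`-close
  (`‖2/G₀² - 2/G²‖ ≤ (4/a³)‖G - G₀‖`, `‖e^J - e^{J₀}‖ ≤ 4‖J - J₀‖`);
* `ShortTime.fkObservable_driver_continuous`: for every `ε > 0` there is `η > 0` such that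
  `|W - W₀| ≤ η` on `[0, t]` implies `‖O_t^{W}(iy) - O_t^{W₀}(iy)‖ ≤ ε` (the principal square
  root being continuous at the square of `W₀`'s observable, which lies in the slit plane).

## References

* D. Chelkak, H. Duminil-Copin, C. Hongler, A. Kemppainen, S. Smirnov, *Convergence of Ising
  interfaces to Schramm's SLE curves*, C. R. Math. Acad. Sci. Paris 352 (2014), §3.
* G. F. Lawler, *Conformally Invariant Processes in the Plane*, AMS (2005), Ch. 4 §4.7
  (Prop. 4.47: continuity of Loewner chains in the driving function).
-/

noncomputable section

open Set Filter Topology Metric MeasureTheory Complex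
open scoped NNReal

namespace Literature.Probability.RandomPlanarGeometry

namespace Loewner

namespace ShortTime

variable {W W₀ : ℝ≥0 → ℝ} {z : ℂ} {t : ℝ≥0}

/-- The Lipschitz constant `K = 2/(δ/2)² = 18/(Im z)²` of the Loewner field on the `δ/2`-tube,
`δ = (2/3) Im z`, in the short-time regime. [folklore] -/
theorem driverK_eq (y : ℝ) : 2 / ((2 * y / 3) / 2) ^ 2 = 18 / y ^ 2 := by
  ring

/-- **Stability of `g_s(z)` in the driver, short-time regime**: if `W₀` is in the short-time
regime at `z`, `W` is continuous and `|W - W₀| ≤ ω` on `[0, t]` with `ω` small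
(`ω ≤ Im z/6`, `ω (e^{18 t/(Im z)²} - 1) < Im z/6`), then
`‖g_s^{W}(z) - g_s^{W₀}(z)‖ ≤ ω (e^{18 s/(Im z)²} - 1)` for `s ≤ t` (the tree's
`dist_map_le_of_driving_close` with `δ = (2/3) Im z`, same starting point). [folklore] -/
theorem dist_map_le (h : ShortTime W₀ z t) (hW : Continuous W) {ω : ℝ} (hω0 : 0 ≤ ω)
    (hω1 : ω ≤ z.im / 6)
    (hω2 : ω * (Real.exp (18 / z.im ^ 2 * t) - 1) < z.im / 6)
    (hWW : ∀ s : ℝ≥0, s ≤ t → |W₀ s - W s| ≤ ω) {s : ℝ≥0} (hs : s ≤ t) :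
    dist (map W s z) (map W₀ s z) ≤ ω * (Real.exp (18 / z.im ^ 2 * s) - 1) := by
  have hy := h.im_pos
  set δ : ℝ≥0 := (2 * z.im / 3).toNNReal with hδ
  have hδpos : 0 < δ := Real.toNNReal_pos.2 (by positivity)
  have hδcoe : (δ : ℝ) = 2 * z.im / 3 := Real.coe_toNNReal _ (by positivity)
  have hK : 2 / ((δ : ℝ) / 2) ^ 2 = 18 / z.im ^ 2 := by rw [hδcoe]; field_simp; ring
  have hfar : ∀ s : ℝ≥0, s ≤ t → (δ : ℝ) ≤ ‖map W₀ s z - W₀ s‖ := fun s hs ↦ by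
    rw [hδcoe]; exact (h.mono hs).norm_map_sub_lower
  have hωδ : ω ≤ δ / 4 := by rw [hδcoe]; linarith
  have hsmall : dist z z * Real.exp (2 / ((δ : ℝ) / 2) ^ 2 * t) +
      ω * (Real.exp (2 / ((δ : ℝ) / 2) ^ 2 * t) - 1) < δ / 4 := by
    rw [dist_self, zero_mul, zero_add, hK, hδcoe]
    linarith
  have key := (dist_map_le_of_driving_close h.cont hW h.lt hδpos hfar hω0 hωδ hWW hsmall).2 s hs
  rw [dist_self, zero_mul, zero_add, hK] at key
  exact key

/-- `‖2/G₀ ² - 2/G²‖ ≤ (4/a³) ‖G - G₀‖` when `‖G‖, ‖G₀‖ ≥ a > 0` (from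
`2/G₀² - 2/G² = (2/G₀ + 2/G)(1/G₀ - 1/G)` and `1/G₀ - 1/G = (G - G₀)/(G G₀)`). [folklore] -/
theorem norm_coeff_sub_coeff_le {G G₀ : ℂ} {a : ℝ} (ha : 0 < a) (hG : a ≤ ‖G‖) (hG₀ : a ≤ ‖G₀‖) :
    ‖(-2 : ℂ) / (G * G) - (-2) / (G₀ * G₀)‖ ≤ 4 / a ^ 3 * ‖G - G₀‖ := by
  have hG0 : G ≠ 0 := norm_pos_iff.1 (ha.trans_le hG)
  have hG₀0 : G₀ ≠ 0 := norm_pos_iff.1 (ha.trans_le hG₀)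
  have hid : (-2 : ℂ) / (G * G) - (-2) / (G₀ * G₀) = (2 / G₀ + 2 / G) * ((G - G₀) / (G * G₀)) := by
    field_simp
    ring
  rw [hid, norm_mul, norm_div, norm_mul]
  have h1 : ‖2 / G₀ + 2 / G‖ ≤ 4 / a := by
    calc ‖2 / G₀ + 2 / G‖ ≤ ‖(2 : ℂ) / G₀‖ + ‖(2 : ℂ) / G‖ := norm_add_le _ _
      _ = 2 / ‖G₀‖ + 2 / ‖G‖ := by simp
      _ ≤ 2 / a + 2 / a := by gcongr
      _ = 4 / a := by ring
  have h2 : ‖G - G₀‖ / (‖G‖ * ‖G₀‖) ≤ ‖G - G₀‖ / (a * a) := by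
    gcongr
  calc ‖2 / G₀ + 2 / G‖ * (‖G - G₀‖ / (‖G‖ * ‖G₀‖))
      ≤ (4 / a) * (‖G - G₀‖ / (a * a)) := mul_le_mul h1 h2 (by positivity) (by positivity)
    _ = 4 / a ^ 3 * ‖G - G₀‖ := by field_simp

/-- **Stability of the exponent `∫₀ᵗ -2/(g_s - W_s)²` in the driver, short-time regime**: under
the hypotheses of `dist_map_le`, with `g`, `g₀` the maximal solutions for `W`, `W₀`,
`‖J(W) - J(W₀)‖ ≤ (4/a³) ω e^{18t/(Im z)²} · t`, `a = (2/3) Im z`. [folklore] -/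
theorem norm_exponent_sub_exponent_le (h : ShortTime W₀ z t) (hW : Continuous W) {ω : ℝ}
    (hω0 : 0 ≤ ω) (hω1 : ω ≤ z.im / 6)
    (hω2 : ω * (Real.exp (18 / z.im ^ 2 * t) - 1) < z.im / 6)
    (hWW : ∀ s : ℝ≥0, s ≤ t → |W₀ s - W s| ≤ ω) {g g₀ : ℝ → ℂ}
    (hg : IsSolution W z g (swallowingTime W z)) (hg₀ : IsSolution W₀ z g₀ (swallowingTime W₀ z)) :
    ‖(∫ s in (0 : ℝ)..t, (-2 : ℂ) / ((g s - W s.toNNReal) * (g s - W s.toNNReal))) -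
        ∫ s in (0 : ℝ)..t, (-2 : ℂ) / ((g₀ s - W₀ s.toNNReal) * (g₀ s - W₀ s.toNNReal))‖ ≤
      4 / (2 * z.im / 3) ^ 3 * (ω * Real.exp (18 / z.im ^ 2 * t)) * t := by
  have hy := h.im_pos
  have h' : ShortTime W z t := ⟨hW, h.im_pos, h.nine⟩
  set a : ℝ := 2 * z.im / 3 with ha
  have ha0 : 0 < a := by positivity
  set E : ℝ := Real.exp (18 / z.im ^ 2 * t) with hE
  have hE1 : 1 ≤ E := Real.one_le_exp (by positivity)
  set f : ℝ → ℂ := fun s ↦ (-2 : ℂ) / ((g s - W s.toNNReal) * (g s - W s.toNNReal)) with hf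
  set f₀ : ℝ → ℂ := fun s ↦ (-2 : ℂ) / ((g₀ s - W₀ s.toNNReal) * (g₀ s - W₀ s.toNNReal)) with hf₀
  have hfc : ContinuousOn f (Icc 0 t) := IsSolution.continuousOn_coeff h'.cont hg hg h'.lt' h'.lt'
  have hf₀c : ContinuousOn f₀ (Icc 0 t) := IsSolution.continuousOn_coeff h.cont hg₀ hg₀ h.lt' h.lt'
  -- pointwise bound on `G - G₀`
  have hGG : ∀ s ∈ Icc (0 : ℝ) t,
      ‖(g s - W s.toNNReal) - (g₀ s - W₀ s.toNNReal)‖ ≤ ω * E := by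
    intro s hs
    have hst : s.toNNReal ≤ t := by
      rw [← NNReal.coe_le_coe, Real.coe_toNNReal s hs.1]; exact hs.2
    have hsT : ((s.toNNReal : ℝ≥0) : WithTop ℝ≥0) < swallowingTime W z := (h'.mono hst).lt
    have hsT₀ : ((s.toNNReal : ℝ≥0) : WithTop ℝ≥0) < swallowingTime W₀ z := (h.mono hst).lt
    have h1 := dist_map_le h hW hω0 hω1 hω2 hWW hst
    rw [map_eq_of_isSolution h'.cont hg hsT, map_eq_of_isSolution h.cont hg₀ hsT₀,
      Real.coe_toNNReal s hs.1, dist_eq_norm] at h1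
    have h2 := hWW _ hst
    have hexp : Real.exp (18 / z.im ^ 2 * s) ≤ E :=
      Real.exp_le_exp.2 (mul_le_mul_of_nonneg_left hs.2 (by positivity))
    have h3 : ‖(W₀ s.toNNReal : ℂ) - W s.toNNReal‖ ≤ ω := by
      rw [← ofReal_sub, norm_real, Real.norm_eq_abs]; exact h2
    have h4 : ω * (Real.exp (18 / z.im ^ 2 * s) - 1) ≤ ω * (E - 1) :=
      mul_le_mul_of_nonneg_left (by linarith) hω0
    calc ‖(g s - W s.toNNReal) - (g₀ s - W₀ s.toNNReal)‖
        = ‖(g s - g₀ s) + ((W₀ s.toNNReal : ℂ) - W s.toNNReal)‖ := by ring_nf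
      _ ≤ ‖g s - g₀ s‖ + ‖(W₀ s.toNNReal : ℂ) - W s.toNNReal‖ := norm_add_le _ _
      _ ≤ ω * (E - 1) + ω := add_le_add (h1.trans h4) h3
      _ = ω * E := by ring
  -- pointwise bound on the integrands
  have hpt : ∀ s ∈ Icc (0 : ℝ) t, ‖f s - f₀ s‖ ≤ 4 / a ^ 3 * (ω * E) := by
    intro s hs
    have hb := norm_coeff_sub_coeff_le ha0 (h'.norm_sub_lower hg hs) (h.norm_sub_lower hg₀ hs)
    refine hb.trans ?_
    gcongr
    exact hGG s hs
  have hint : IntervalIntegrable f volume (0 : ℝ) t := hfc.intervalIntegrable_of_Icc t.coe_nonneg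
  have hint₀ : IntervalIntegrable f₀ volume (0 : ℝ) t := hf₀c.intervalIntegrable_of_Icc t.coe_nonneg
  rw [← intervalIntegral.integral_sub hint hint₀]
  calc ‖∫ s in (0 : ℝ)..t, (f s - f₀ s)‖ ≤ 4 / a ^ 3 * (ω * E) * |(t : ℝ) - 0| := by
        refine intervalIntegral.norm_integral_le_of_norm_le_const fun s hs ↦ ?_
        rw [uIoc_of_le t.coe_nonneg] at hs
        exact hpt s ⟨hs.1.le, hs.2⟩
    _ = 4 / a ^ 3 * (ω * E) * t := by rw [sub_zero, abs_of_nonneg t.coe_nonneg]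

/-- `‖e^J - e^{J₀}‖ ≤ 4 ‖J - J₀‖` when `‖J₀‖ ≤ 1/2` and `‖J - J₀‖ ≤ 1`. [folklore] -/
theorem norm_exp_sub_exp_le {J J₀ : ℂ} (hJ₀ : ‖J₀‖ ≤ 1 / 2) (hJ : ‖J - J₀‖ ≤ 1) :
    ‖exp J - exp J₀‖ ≤ 4 * ‖J - J₀‖ := by
  have hid : exp J - exp J₀ = exp J₀ * (exp (J - J₀) - 1) := by
    rw [mul_sub, mul_one, ← Complex.exp_add]; ring_nf
  rw [hid, norm_mul, norm_exp]
  have h1 : Real.exp J₀.re ≤ 2 :=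
    (Real.exp_le_exp.2 ((re_le_norm J₀).trans hJ₀)).trans exp_half_le_two
  have h2 : ‖exp (J - J₀) - 1‖ ≤ 2 * ‖J - J₀‖ := norm_exp_sub_one_le hJ
  calc Real.exp J₀.re * ‖exp (J - J₀) - 1‖ ≤ 2 * (2 * ‖J - J₀‖) :=
        mul_le_mul h1 h2 (norm_nonneg _) (by norm_num)
    _ = 4 * ‖J - J₀‖ := by ring

/-- **Stability of the square of the observable in the driver (quantitative)**: in the short-time
regime at `z`, with `|W - W₀| ≤ ω` on `[0, t]` and `ω` small, the squares
`b = z g_t'/(g_t - W_t)` satisfy `‖b(W) - b(W₀)‖ ≤ C(z, t) ω` for an explicit `C`. [folklore] -/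
theorem norm_base_sub_base_le (h : ShortTime W₀ z t) (hW : Continuous W) {ω : ℝ} (hω0 : 0 ≤ ω)
    (hω1 : ω ≤ z.im / 6)
    (hω2 : ω * (Real.exp (18 / z.im ^ 2 * t) - 1) < z.im / 6)
    (hω3 : 4 / (2 * z.im / 3) ^ 3 * (ω * Real.exp (18 / z.im ^ 2 * t)) * t ≤ 1)
    (hWW : ∀ s : ℝ≥0, s ≤ t → |W₀ s - W s| ≤ ω) :
    ‖z * deriv (map W t) z / (map W t z - W t) - z * deriv (map W₀ t) z / (map W₀ t z - W₀ t)‖ ≤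
      ‖z‖ * ((4 * (4 / (2 * z.im / 3) ^ 3 * Real.exp (18 / z.im ^ 2 * t) * t)) / (2 * z.im / 3) +
        2 * Real.exp (18 / z.im ^ 2 * t) / (2 * z.im / 3) ^ 2) * ω := by
  have hy := h.im_pos
  have h' : ShortTime W z t := ⟨hW, h.im_pos, h.nine⟩
  obtain ⟨g, hg⟩ := h'.exists_sol
  obtain ⟨g₀, hg₀⟩ := h.exists_sol
  set a : ℝ := 2 * z.im / 3 with ha
  have ha0 : 0 < a := by positivity
  set E : ℝ := Real.exp (18 / z.im ^ 2 * t) with hE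
  have hE1 : 1 ≤ E := Real.one_le_exp (by positivity)
  set L : ℝ := 4 / a ^ 3 * E * t with hL
  -- the pieces
  set d : ℂ := deriv (map W t) z with hd
  set d₀ : ℂ := deriv (map W₀ t) z with hd₀
  set G : ℂ := map W t z - W t with hGdef
  set G₀ : ℂ := map W₀ t z - W₀ t with hG₀def
  have hGa : a ≤ ‖G‖ := h'.norm_map_sub_lower
  have hG₀a : a ≤ ‖G₀‖ := h.norm_map_sub_lower
  have hG0 : G ≠ 0 := h'.map_sub_ne_zero
  have hG₀0 : G₀ ≠ 0 := h.map_sub_ne_zero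
  have hd₀2 : ‖d₀‖ ≤ 2 := h.norm_deriv_map_le
  -- `G - G₀`
  have hGG : ‖G - G₀‖ ≤ ω * E := by
    have h1 := dist_map_le h hW hω0 hω1 hω2 hWW le_rfl
    rw [dist_eq_norm] at h1
    have h2 := hWW t le_rfl
    calc ‖G - G₀‖ = ‖(map W t z - map W₀ t z) + ((W₀ t : ℂ) - W t)‖ := by
          rw [hGdef, hG₀def]; ring_nf
      _ ≤ ‖map W t z - map W₀ t z‖ + ‖(W₀ t : ℂ) - W t‖ := norm_add_le _ _
      _ ≤ ω * (E - 1) + ω := by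
          gcongr
          rw [← ofReal_sub, norm_real, Real.norm_eq_abs]; exact h2
      _ = ω * E := by ring
  -- `d - d₀`
  have hdd : ‖d - d₀‖ ≤ 4 * (L * ω) := by
    have hJ := norm_exponent_sub_exponent_le h hW hω0 hω1 hω2 hWW hg hg₀
    have hJ' : ‖(∫ s in (0 : ℝ)..t, (-2 : ℂ) / ((g s - W s.toNNReal) * (g s - W s.toNNReal))) -
        ∫ s in (0 : ℝ)..t, (-2 : ℂ) / ((g₀ s - W₀ s.toNNReal) * (g₀ s - W₀ s.toNNReal))‖ ≤ L * ω := by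
      refine hJ.trans (le_of_eq ?_); rw [hL]; ring
    have hJ1 : ‖(∫ s in (0 : ℝ)..t, (-2 : ℂ) / ((g s - W s.toNNReal) * (g s - W s.toNNReal))) -
        ∫ s in (0 : ℝ)..t, (-2 : ℂ) / ((g₀ s - W₀ s.toNNReal) * (g₀ s - W₀ s.toNNReal))‖ ≤ 1 :=
      hJ.trans hω3
    rw [hd, hd₀, h'.deriv_map_eq hg, h.deriv_map_eq hg₀]
    have key := norm_exp_sub_exp_le (h.norm_exponent_le hg₀) hJ1
    linarith
  -- assemble
  have hid : z * d / G - z * d₀ / G₀ = z * ((d - d₀) / G + d₀ * ((G₀ - G) / (G * G₀))) := by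
    field_simp
    ring
  rw [hid, norm_mul]
  have hrest : ‖(d - d₀) / G + d₀ * ((G₀ - G) / (G * G₀))‖ ≤
      (4 * (4 / a ^ 3 * E * t) / a + 2 * E / a ^ 2) * ω := by
    calc ‖(d - d₀) / G + d₀ * ((G₀ - G) / (G * G₀))‖
        ≤ ‖(d - d₀) / G‖ + ‖d₀ * ((G₀ - G) / (G * G₀))‖ := norm_add_le _ _
      _ = ‖d - d₀‖ / ‖G‖ + ‖d₀‖ * (‖G₀ - G‖ / (‖G‖ * ‖G₀‖)) := by
          rw [norm_div, norm_mul, norm_div, norm_mul]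
      _ ≤ 4 * (L * ω) / a + 2 * (ω * E / (a * a)) := by
          gcongr
          · rw [norm_sub_rev]; exact hGG
      _ = (4 * L / a + 2 * E / a ^ 2) * ω := by
          field_simp
      _ = (4 * (4 / a ^ 3 * E * t) / a + 2 * E / a ^ 2) * ω := by rw [hL]
  calc ‖z‖ * ‖(d - d₀) / G + d₀ * ((G₀ - G) / (G * G₀))‖
      ≤ ‖z‖ * ((4 * (4 / a ^ 3 * E * t) / a + 2 * E / a ^ 2) * ω) :=
        mul_le_mul_of_nonneg_left hrest (norm_nonneg z)
    _ = ‖z‖ * (4 * (4 / a ^ 3 * E * t) / a + 2 * E / a ^ 2) * ω := by ring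

/-- **The FK observable depends continuously on the driving function (short-time regime, imaginary
axis)**: for `W₀` continuous, `y > 0`, `9t ≤ y²` and `ε > 0` there is `η > 0` such that every
continuous `W` with `|W - W₀| ≤ η` on `[0, t]` has `‖O_t^{W}(iy) - O_t^{W₀}(iy)‖ ≤ ε` — the
squares are `C ω`-close (`norm_base_sub_base_le`) and the principal square root is continuous at
the square of `W₀`'s observable, which lies in the slit plane (`base_mem_slitPlane`). This is the
continuity of `W ↦ M_t(z)` behind "the convergence of `G_t^δ` to `G_t` … (which follows from the
convergences of `W^δ_t` to `W_t`)" (CDHKS 2014, §3), via Loewner driver stability (Lawler 2005,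
§4.7). [cite: CDHKSCRAS2014, §3] -/
theorem fkObservable_driver_continuous {y : ℝ} (h : ShortTime W₀ (I * y) t) {ε : ℝ} (hε : 0 < ε) :
    ∃ η > 0, ∀ W : ℝ≥0 → ℝ, Continuous W → (∀ s : ℝ≥0, s ≤ t → |W₀ s - W s| ≤ η) →
      ‖fkObservable W t (I * y) - fkObservable W₀ t (I * y)‖ ≤ ε := by
  have hy : 0 < y := by simpa using h.im_pos
  have hyim : (I * (y : ℂ)).im = y := by simp
  -- continuity of the principal square root at the base of `W₀`
  set b₀ : ℂ := I * y * deriv (map W₀ t) (I * y) / (map W₀ t (I * y) - W₀ t) with hb₀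
  have hcont : ContinuousAt (fun x : ℂ ↦ x ^ (2⁻¹ : ℂ)) b₀ :=
    continuousAt_cpow_const h.base_mem_slitPlane
  obtain ⟨ρ, hρ, hρε⟩ := Metric.continuousAt_iff.1 hcont ε hε
  -- the constants
  set a : ℝ := 2 * y / 3 with ha
  have ha0 : 0 < a := by positivity
  set E : ℝ := Real.exp (18 / y ^ 2 * t) with hE
  have hE0 : 0 < E := Real.exp_pos _
  have hE1 : 1 ≤ E := Real.one_le_exp (by positivity)
  set L : ℝ := 4 / a ^ 3 * E * t with hL
  have hL0 : 0 ≤ L := by positivity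
  set M : ℝ := ‖I * (y : ℂ)‖ * (4 * L / a + 2 * E / a ^ 2) with hM
  have hM0 : 0 ≤ M := by positivity
  set η : ℝ := min (min (y / 6 / E) (1 / (L + 1))) (ρ / (2 * (M + 1))) with hη
  have hηpos : 0 < η := by positivity
  refine ⟨η, hηpos, fun W hW hWW ↦ ?_⟩
  have hη1 : η ≤ y / 6 / E := (min_le_left _ _).trans (min_le_left _ _)
  have hη2 : η ≤ 1 / (L + 1) := (min_le_left _ _).trans (min_le_right _ _)
  have hη3 : η ≤ ρ / (2 * (M + 1)) := min_le_right _ _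
  -- the smallness conditions of `norm_base_sub_base_le`
  have hω1 : η ≤ (I * (y : ℂ)).im / 6 := by
    rw [hyim]
    calc η ≤ y / 6 / E := hη1
      _ ≤ y / 6 := div_le_self (by positivity) hE1
  have hω2 : η * (Real.exp (18 / (I * (y : ℂ)).im ^ 2 * t) - 1) < (I * (y : ℂ)).im / 6 := by
    rw [hyim, ← hE]
    have h1 : η * (E - 1) < η * E := by nlinarith
    have h2 : η * E ≤ y / 6 := by rwa [le_div_iff₀ hE0] at hη1
    linarith
  have hω3 : 4 / (2 * (I * (y : ℂ)).im / 3) ^ 3 * (η * Real.exp (18 / (I * (y : ℂ)).im ^ 2 * t)) * t ≤ 1 := by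
    rw [hyim, ← hE, ← ha]
    have h1 : 4 / a ^ 3 * (η * E) * t = L * η := by rw [hL]; ring
    rw [h1]
    have h2 : η * (L + 1) ≤ 1 := by rwa [le_div_iff₀ (by positivity)] at hη2
    nlinarith
  have hbase := norm_base_sub_base_le h hW hηpos.le hω1 hω2 hω3 hWW
  rw [hyim] at hbase
  have hbase' : ‖I * y * deriv (map W t) (I * y) / (map W t (I * y) - W t) - b₀‖ ≤ M * η := by
    refine hbase.trans (le_of_eq ?_)
    rw [hM, hL, ha, hE]
  have hlt : M * η < ρ := by
    have h1 : η * (2 * (M + 1)) ≤ ρ := by rwa [le_div_iff₀ (by positivity)] at hη3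
    nlinarith
  have hdist : dist (I * y * deriv (map W t) (I * y) / (map W t (I * y) - W t)) b₀ < ρ := by
    rw [dist_eq_norm]; exact hbase'.trans_lt hlt
  have := hρε hdist
  rw [dist_eq_norm] at this
  exact this.le

end ShortTime

end Loewner

end Literature.Probability.RandomPlanarGeometry
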